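import Literature.NumberTheory.EllipticCurves.CongruentNumberOddMonskySelmerKernel
import Literature.NumberTheory.EllipticCurves.SelmerFiniteProofs
import HarnessLib

/-!
# Monsky's `2`-Selmer formula for `E_n : y² = x³ − n²x`, `n = p₁⋯p_k` ODD: EQUALITY `#Sel⁽²⁾(E_n/ℚ) = 2^{2+s(n)}`

P. Monsky, appendix to D. R. Heath-Brown, Invent. Math. 118 (1994), odd case (typescript p. 39): for `n = p₁⋯p_k`
with distinct odd primes, "`2^{s(D)}` is the size of the kernel of `M = ( A + D₂  D₂ ; D₂  A + D₋₂ )`",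
`#S⁽²⁾ = 2^{2+s(D)}` (Heath-Brown §1). The tree vendored this as the NAMED FACT
`HeathBrown1994.monsky_card_selmerGroup_two_odd`; `CongruentNumberOddMonskySelmerBound.lean` proved the `≤` half.
THIS FILE PROVES THE `≥` HALF AND DISCHARGES THE FACT:

* `card_selmerGroup_two_ge_pow` — `2^{2+s(n)} ≤ #Sel⁽²⁾(E_n/ℚ)`: the normalising character
  `ν = (v₂(a), sign(b)) : Sel⁽²⁾ → (ℤ/2)²` is SURJECTIVE (the torsion-pair classes `(2n², −n)`, `(n, −n²)`, `(2n, n)`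
  take the values `(1,1), (0,1), (1,0)`), so `[Sel⁽²⁾ : ker ν] = 4`; and `(x; y) ↦ c(∏pᵢ^{xᵢ}, ∏pᵢ^{xᵢ+yᵢ})`
  (`CongruentNumberOddMonskySelmerKernel.lean`) is an INJECTION `ker M ↪ ker ν` (coordinates
  `(v_{pᵢ}(a); v_{pᵢ}(a) + v_{pᵢ}(b)) = (x; y)`); `Sel⁽²⁾` is finite (Silverman X.4.2(b), tree);
* `card_selmerGroup_two_eq_pow` — with the `≤` half: **`#Sel⁽²⁾(E_n/ℚ) = 2^{2+s(n)}`**;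
* **`HeathBrown1994.monsky_card_selmerGroup_two_odd_holds : monsky_card_selmerGroup_two_odd`** — the named fact
  is a theorem of the tree.

Cell `bsd-monsky` (prover-B). With `CongruentNumberEvenMonskySelmerExact.lean` BOTH cases of Monsky's theorem are
discharged: Heath-Brown's `s(D)` is computed by the kernel for every square-free `D`.

## References

* [HeathBrown1994SelmerCongruentII] D. R. Heath-Brown, Invent. Math. 118 (1994) 331–370: §1 (typescript p. 1
  L14–L20); Appendix (P. Monsky) p. 38 L17 – p. 39 L33 (odd `D`).
* [SilvermanAEC2009] J. H. Silverman, *The Arithmetic of Elliptic Curves*, 2nd ed., Prop. X.1.4, Thm. X.4.2,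
  Prop. X.4.9.
-/

noncomputable section

open scoped Classical

open WeierstrassCurve WeierstrassCurve.Affine WeierstrassCurve.Affine.Point
open Literature.NumberTheory.GaloisRepresentations
open Literature.NumberTheory.EllipticCurves.KramerTwoDescent
open Literature.NumberTheory.EllipticCurves.TwoDescentLocal
open Literature.NumberTheory.EllipticCurves.HeathBrown1994
open Literature.NumberTheory.EllipticCurves.CongruentNumberEvenMonskySelmer
open Literature.NumberTheory.EllipticCurves.CongruentNumberOddMonskySelmer
open Literature.NumberTheory.EllipticCurves.MonskySelmerCandidates
open Literature.NumberTheory.EllipticCurves.CongruentNumberOddMonskySelmerKernel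
open IsDedekindDomain NumberField Rat.HeightOneSpectrum Matrix

namespace Literature.NumberTheory.EllipticCurves

namespace CongruentNumberOddMonskySelmerExact

variable {k : ℕ} {p : Fin k → ℕ}

/-- The two values of a bit. [folklore] -/
private theorem zmod2_cases (x : ZMod 2) : x = 0 ∨ x = 1 := by revert x; decide

/-- `x + (x + y) = y` in `ℤ/2`. [folklore] -/
private theorem add_add_self_zmod2 (x y : ZMod 2) : x + (x + y) = y := by revert x y; decide

/-- `∏ pᵢ ≠ 0`. [folklore] -/
private theorem n_ne_zero (hp : ∀ i, (p i).Prime) : ∏ i, p i ≠ 0 :=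
  Finset.prod_ne_zero_iff.mpr fun i _ => (hp i).ne_zero

/-- `v₂(∏ pᵢ) = 0` for odd primes `pᵢ`. [folklore] -/
private theorem padicValRat_two_n (hp : ∀ i, (p i).Prime) (hp2 : ∀ i, p i ≠ 2) (hinj : Function.Injective p) :
    padicValRat 2 ((∏ i, p i : ℕ) : ℚ) = 0 := by
  have hprod : ((∏ j, p j : ℕ) : ℚ) = (bitProd p (fun _ => 1) : ℚ) := by rw [cast_bitProd]; push_cast; simp
  rw [hprod, padicValRat_bitProd_of_forall_ne hp hinj _ Nat.prime_two hp2]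

/-- `v₂(2) = 1`. [folklore] -/
private theorem padicValRat_two_two : padicValRat 2 (2 : ℚ) = 1 := by
  have h := padicValRat.self (p := 2) one_lt_two
  simpa using h

/-- `signBit` of a negative rational is `1`. [folklore] -/
private theorem signBit_of_neg {a : ℚ} (ha : a < 0) : signBit a = 1 := by
  unfold signBit; rw [if_pos ha]

/-- **Monsky's `2`-Selmer formula for odd `n`, LOWER-BOUND HALF, for every number of prime factors**:
for distinct odd primes `p₁, …, p_k` and `n = p₁⋯p_k`, `2^{2+s(n)} ≤ #Sel⁽²⁾(E_n/ℚ)`, `s(n) = 2k − rank_{𝔽₂} M`,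
`M = ( A + D₂  D₂ ; D₂  A + D₋₂ )` (`monskyMatrixOdd`). Proof: `ν = (v₂(a), sign(b))` on `Sel⁽²⁾` is surjective
onto `(ℤ/2)²` (torsion-pair classes), and `ker M ↪ ker ν` by `(x; y) ↦ c(∏pᵢ^{xᵢ}, ∏pᵢ^{xᵢ+yᵢ})`; `Sel⁽²⁾` is finite.
[cite: HeathBrown1994SelmerCongruentII, Appendix (Monsky), typescript p. 38 L17 – p. 39 L33; §1 p. 1 L14–L20]
[cite: SilvermanAEC2009, Prop. X.1.4, Thm. X.4.2, Prop. X.4.9] -/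
theorem card_selmerGroup_two_ge_pow (hp : ∀ i, (p i).Prime) (hp2 : ∀ i, p i ≠ 2) (hinj : Function.Injective p) :
    2 ^ (2 + monskySelmerRankOdd p) ≤ Nat.card ((congruentNumberCurve (∏ i, p i)).selmerGroup 2) := by
  haveI := isElliptic_congruentNumberCurve (n_ne_zero hp)
  haveI : Fact (Nat.Prime 2) := ⟨Nat.prime_two⟩
  haveI : ∀ i, Fact (p i).Prime := fun i => ⟨hp i⟩
  have hT := splitTwoTorsion_cn (∏ i, p i)
  set W := congruentNumberCurve (∏ i, p i) with hW
  haveI : Finite (W.selmerGroup 2) := W.finite_selmerGroup_holds (n := 2) two_ne_zero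
  -- the components, the normalising character `ν` and the coordinates `ψ`, as additive maps
  obtain ⟨F₁, hF₁⟩ : ∃ F₁ : galH1Torsion W 2 →+ Additive (SqUnits ℚ),
      ∀ c, F₁ c = kummerEquiv ℚ 2 (W.twoTorsionCharH1 hT c) :=
    ⟨(kummerEquiv ℚ 2).toAddMonoidHom.comp (W.twoTorsionCharH1 hT), fun c => rfl⟩
  obtain ⟨F₂, hF₂⟩ : ∃ F₂ : galH1Torsion W 2 →+ Additive (SqUnits ℚ),
      ∀ c, F₂ c = kummerEquiv ℚ 2 (W.twoTorsionCharH1 hT.swap₁₂ c) :=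
    ⟨(kummerEquiv ℚ 2).toAddMonoidHom.comp (W.twoTorsionCharH1 hT.swap₁₂), fun c => rfl⟩
  obtain ⟨ν, hν⟩ : ∃ ν : galH1Torsion W 2 →+ ZMod 2 × ZMod 2,
      ∀ c, ν c = (parityHom 2 (F₁ c), signHom (F₂ c)) :=
    ⟨((parityHom 2).comp F₁).prod (signHom.comp F₂), fun c => rfl⟩
  obtain ⟨ψ, hψ⟩ : ∃ ψ : galH1Torsion W 2 →+ (Fin k ⊕ Fin k → ZMod 2), ∀ c,
      ψ c = Sum.elim (fun i => parityHom (p i) (F₁ c)) (fun i => parityHom (p i) (F₁ c) + parityHom (p i) (F₂ c)) :=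
    ⟨AddMonoidHom.pi fun s => Sum.elim (fun i => (parityHom (p i)).comp F₁)
        (fun i => (parityHom (p i)).comp F₁ + (parityHom (p i)).comp F₂) s,
      fun c => by funext s; rcases s with i | i <;> rfl⟩
  -- their values on the class of a pair `(a, b)`
  have hval : ∀ a b : ℚˣ, ν (W.twoDescentClass hT a b) = (parityBit 2 (a : ℚ), signBit (b : ℚ)) ∧
      ψ (W.twoDescentClass hT a b) =
        Sum.elim (fun i => parityBit (p i) (a : ℚ)) (fun i => parityBit (p i) (a : ℚ) + parityBit (p i) (b : ℚ)) := by
    intro a b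
    have h1 : F₁ (W.twoDescentClass hT a b) = Additive.ofMul (sqClass (a : ℚ)) := by
      rw [hF₁, W.kummerEquiv_twoTorsionCharH1_twoDescentClass hT a b,
        CongruentNumberTwicePrimePairSelmer.mk_eq_sqClass]
    have h2 : F₂ (W.twoDescentClass hT a b) = Additive.ofMul (sqClass (b : ℚ)) := by
      rw [hF₂, W.kummerEquiv_twoTorsionCharH1_swap_twoDescentClass hT a b,
        CongruentNumberTwicePrimePairSelmer.mk_eq_sqClass]
    refine ⟨?_, ?_⟩
    · rw [hν, h1, h2, parityHom_sqClass a.ne_zero, signHom_sqClass b.ne_zero]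
    · rw [hψ, h1, h2]
      congr 1 <;> funext i
      · exact parityHom_sqClass (Units.ne_zero _)
      · rw [parityHom_sqClass (Units.ne_zero _), parityHom_sqClass (Units.ne_zero _)]
  set νS : W.selmerGroup 2 →+ ZMod 2 × ZMod 2 := ν.comp (W.selmerGroup 2).subtype with hνS
  -- (a) `ν` is surjective on `Sel⁽²⁾`: the torsion pairs
  have hn0 : ((∏ i, p i : ℕ) : ℚ) ≠ 0 := by exact_mod_cast n_ne_zero hp
  set N : ℚ := ((∏ i, p i : ℕ) : ℚ) with hN
  have hNpos : 0 < N := by rw [hN]; exact_mod_cast Nat.pos_of_ne_zero (n_ne_zero hp)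
  have v2N : parityBit 2 N = 0 := by unfold parityBit; rw [hN, padicValRat_two_n hp hp2 hinj]; rfl
  have v22 : parityBit 2 (2 : ℚ) = 1 := by unfold parityBit; rw [padicValRat_two_two]; rfl
  have mem_range : ∀ a b : ℚˣ, W.twoDescentClass hT a b ∈ W.selmerGroup 2 →
      (parityBit 2 (a : ℚ), signBit (b : ℚ)) ∈ νS.range := fun a b hab =>
    ⟨⟨_, hab⟩, by rw [hνS, AddMonoidHom.comp_apply, AddSubgroup.coe_subtype, (hval a b).1]⟩
  have r00 : ((0 : ZMod 2), (0 : ZMod 2)) ∈ νS.range := ⟨0, by rw [_root_.map_zero]; rfl⟩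
  have r11 : ((1 : ZMod 2), (1 : ZMod 2)) ∈ νS.range := by
    -- `T₁ = (−n, 0)`: pair `(2n², −n)`
    have hmem := twoDescentClass_mem_selmerGroup_T₁ W hT (Units.mk0 ((-N - 0) * (-N - N)) (by
        rw [show (-N - 0) * (-N - N) = 2 * (N * N) by ring]; exact mul_ne_zero two_ne_zero (mul_ne_zero hn0 hn0)))
      (Units.mk0 (-N - 0) (by rw [sub_zero]; exact neg_ne_zero.mpr hn0)) rfl rfl
    have key := mem_range _ _ hmem
    rw [Units.val_mk0, Units.val_mk0, show (-N - 0) * (-N - N) = 2 * (N * N) by ring,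
      parityBit_mul two_ne_zero (mul_ne_zero hn0 hn0), parityBit_mul hn0 hn0, v22, v2N, add_zero, add_zero,
      signBit_of_neg (by rw [sub_zero]; exact neg_neg_of_pos hNpos)] at key
    exact key
  have r01 : ((0 : ZMod 2), (1 : ZMod 2)) ∈ νS.range := by
    -- `T₂ = (0, 0)`: pair `(n, −n²)`
    have hb0 : ((0 : ℚ) - -N) * (0 - N) ≠ 0 := by
      rw [show ((0 : ℚ) - -N) * (0 - N) = -(N * N) by ring]; exact neg_ne_zero.mpr (mul_ne_zero hn0 hn0)
    have hmem := twoDescentClass_mem_selmerGroup_T₂ W hT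
      (Units.mk0 ((0 : ℚ) - -N) (by rw [sub_neg_eq_add, zero_add]; exact hn0)) (Units.mk0 _ hb0) rfl rfl
    have key := mem_range _ _ hmem
    rw [Units.val_mk0, Units.val_mk0, show (0 : ℚ) - -N = N by ring, v2N,
      signBit_of_neg (by rw [show N * (0 - N) = -(N * N) by ring]; exact neg_neg_of_pos (mul_pos hNpos hNpos))]
      at key
    exact key
  have r10 : ((1 : ZMod 2), (0 : ZMod 2)) ∈ νS.range := by
    -- `T₃ = (n, 0)`: pair `(2n, n)`
    have hmem := twoDescentClass_mem_selmerGroup_T₃ W hT (Units.mk0 (N - -N) (by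
        rw [show N - -N = 2 * N by ring]; exact mul_ne_zero two_ne_zero hn0))
      (Units.mk0 (N - 0) (by rw [sub_zero]; exact hn0)) rfl rfl
    have key := mem_range _ _ hmem
    rw [Units.val_mk0, Units.val_mk0, show N - -N = 2 * N by ring, parityBit_mul two_ne_zero hn0, v22, v2N, add_zero,
      sub_zero, (signBit_eq_zero_iff hn0).mpr hNpos] at key
    exact key
  have hrange : νS.range = ⊤ := by
    rw [eq_top_iff]
    rintro ⟨x, y⟩ -
    rcases zmod2_cases x with hx | hx <;> rcases zmod2_cases y with hy | hy <;> subst hx <;> subst hy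
    · exact r00
    · exact r01
    · exact r10
    · exact r11
  have hidx : νS.ker.index = 4 := by
    rw [AddSubgroup.index_ker, hrange, AddSubgroup.card_top, Nat.card_prod, Nat.card_zmod]
  -- (b) `ker M ↪ ker ν`
  let Φ : LinearMap.ker (monskyMatrixOdd p).mulVecLin → νS.ker := fun x =>
    ⟨⟨W.twoDescentClass hT (Units.mk0 (bitProd p (fun i => x.1 (Sum.inl i)) : ℚ) (cast_bitProd_ne_zero hp _))
        (Units.mk0 (bitProd p ((fun i => x.1 (Sum.inl i)) + fun i => x.1 (Sum.inr i)) : ℚ) (cast_bitProd_ne_zero hp _)),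
      twoDescentClass_kernel_mem_selmerGroup_odd hp hp2 hinj (by
        have hx := x.2
        rw [LinearMap.mem_ker, Matrix.mulVecLin_apply] at hx
        have hxe : Sum.elim (fun i => x.1 (Sum.inl i)) (fun i => x.1 (Sum.inr i)) = x.1 := by
          funext s; rcases s with i | i <;> rfl
        rw [hxe]; exact hx)⟩, by
      rw [AddMonoidHom.mem_ker, hνS, AddMonoidHom.comp_apply, AddSubgroup.coe_subtype, (hval _ _).1,
        Units.val_mk0, Units.val_mk0, Prod.mk_eq_zero]
      refine ⟨?_, (signBit_eq_zero_iff (cast_bitProd_ne_zero hp _)).mpr (by exact_mod_cast bitProd_pos hp _)⟩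
      unfold parityBit
      rw [padicValRat_bitProd_of_forall_ne hp hinj _ Nat.prime_two hp2]; rfl⟩
  have hψcl : ∀ x : LinearMap.ker (monskyMatrixOdd p).mulVecLin,
      ψ (((Φ x : νS.ker) : W.selmerGroup 2) : galH1Torsion W 2) = x.1 := by
    intro x
    change ψ (W.twoDescentClass hT _ _) = x.1
    rw [(hval _ _).2]
    funext s
    rcases s with i | i
    · rw [Sum.elim_inl, Units.val_mk0, parityBit_bitProd hp hinj]
    · rw [Sum.elim_inr, Units.val_mk0, Units.val_mk0, parityBit_bitProd hp hinj, parityBit_bitProd hp hinj, Pi.add_apply,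
        add_add_self_zmod2]
  have hΦ : Function.Injective Φ := by
    intro x y hxy
    apply Subtype.ext
    rw [← hψcl x, ← hψcl y, hxy]
  have hker : 2 ^ (2 * k - (monskyMatrixOdd p).rank) ≤ Nat.card νS.ker := by
    have := Nat.card_le_card_of_injective Φ hΦ
    rwa [natCard_ker_mulVecLin_eq, Fintype.card_sum, Fintype.card_fin, ← two_mul] at this
  calc 2 ^ (2 + monskySelmerRankOdd p) = 2 ^ (2 * k - (monskyMatrixOdd p).rank) * 4 := by
        rw [monskySelmerRankOdd, pow_add]; ring
    _ ≤ Nat.card νS.ker * νS.ker.index := by rw [hidx]; exact Nat.mul_le_mul_right 4 hker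
    _ = Nat.card (W.selmerGroup 2) := νS.ker.card_mul_index

/-- **MONSKY'S `2`-SELMER FORMULA FOR ODD `n` — EQUALITY, for every number of prime factors**: for distinct odd
primes `p₁, …, p_k` and `n = p₁⋯p_k`, `#Sel⁽²⁾(E_n/ℚ) = 2^{2+s(n)}`, `s(n) = 2k − rank_{𝔽₂} M`,
`M = ( A + D₂  D₂ ; D₂  A + D₋₂ )`. [cite: HeathBrown1994SelmerCongruentII, Appendix (Monsky), typescript p. 38 L17 – p. 39 L33; §1 p. 1 L14–L20] -/
theorem card_selmerGroup_two_eq_pow (hp : ∀ i, (p i).Prime) (hp2 : ∀ i, p i ≠ 2) (hinj : Function.Injective p) :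
    Nat.card ((congruentNumberCurve (∏ i, p i)).selmerGroup 2) = 2 ^ (2 + monskySelmerRankOdd p) :=
  le_antisymm (CongruentNumberOddMonskySelmer.card_selmerGroup_two_le_pow hp hp2 hinj)
    (card_selmerGroup_two_ge_pow hp hp2 hinj)

end CongruentNumberOddMonskySelmerExact

/-- **MONSKY'S THEOREM, ODD CASE, DISCHARGED**: the named fact `HeathBrown1994.monsky_card_selmerGroup_two_odd`
(appendix to Heath-Brown, Invent. Math. 118 (1994), odd `D = p₁⋯p_k` with distinct odd primes:
`#Sel₂(E_D/ℚ) = 2^{2+s(D)}`, `s(D) = 2k − rank M`, `M = ( A + D₂  D₂ ; D₂  A + D₋₂ )`) is a THEOREM of the tree: a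
complete `2`-descent on the cohomological Selmer group (Silverman AEC X.1.4/X.4.9) — upper bound
`CongruentNumberOddMonskySelmerBound.lean`, lower bound `CongruentNumberOddMonskySelmerExact.lean`.
[cite: HeathBrown1994SelmerCongruentII, Appendix (Monsky), typescript p. 39 L10–L33; §1 p. 1 L14–L20] -/
theorem HeathBrown1994.monsky_card_selmerGroup_two_odd_holds : HeathBrown1994.monsky_card_selmerGroup_two_odd :=
  fun _ _ hp hodd hinj =>
    CongruentNumberOddMonskySelmerExact.card_selmerGroup_two_eq_pow hp
      (fun i h => Nat.not_even_iff_odd.mpr (hodd i) (h ▸ even_two)) hinj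

end Literature.NumberTheory.EllipticCurves

end
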